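import Summits.CriticalPhenomena.CardyFormulaZ2.Theorems.CardyComplexConeEdgePrecompactUFRSJunctionFunnelScaled

/-!
# The junction funnel, part F: reading the gate in a rotation frame (chirality by mirroring)
(line `qkz-strip-boundary-arm` of crux `CardyComplexCone.EdgePrecompact`, stmt-CriticalPhenomena-11387;
sixth file of the registered sub-goal S2 = `ufrs_junctionFunnel`, lead c5, wave 4; registered
anchor `gate_read_JF`)

The junction gate `ufrsJunctionGate φ corner N h` (`…UFRSJunctionGate.lean`) places the
reference arch by an arbitrary automorphism `φ` of `ℤ²`; the funnel transports ORBITS only along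
orientation-preserving frames `ψ` (`…UFRSJunctionFunnelFrame.lean`), because Smirnov's successor
map is chiral. For a junction of the opposite chirality the gate is placed by `φ = ρ ∘ ψ` with the
reflection `ρ = reflectIso 0` (`(x₀, x₁) ↦ (-x₀, x₁)`), and the arch seen in the frame `ψ` is the
mirror image of the reference arch: the open path is `ρ ∘ P`, the dual path has the mirrored
faces `f ↦ ρ f - e₀` (lower-left corners of the mirrored unit squares), and the edge separating
two mirrored faces is the mirror image of the separating edge (`sepEdge_reflect_JF`, by the
midpoint characterisation `sepEdge_eq_of_sum_JF`). `gate_read_JF` (registered anchor) packages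
both chiralities `s = ±1`: from the gate in the frame it produces a `ψ '' ω`-open lattice walk,
a face walk from the face of a corner `(v₀, k₀)` crossing `ψ '' ω`-closed edges, and their
positions as mirror images (`x₀ ↦ s x₀`, faces `f₀ ↦ s f₀ - (1 - s)/2`) of the reference regions.
Also: `relabel_trans_JF` (relabelling along a composite automorphism).

References: S. Smirnov, C. R. Acad. Sci. Paris 333 (2001), §2; G. Grimmett, *Percolation* (1999),
§11.7 (reflection symmetry in RSW-type constructions).
-/

set_option linter.unusedVariables false

namespace Summit.CriticalPhenomena.CardyFormulaZ2.Cruxes.EdgePrecompact.QkzStripBoundaryArm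

open MeasureTheory Filter Set Metric
open scoped Topology BigOperators Pointwise
open Literature.Probability.LatticeModels Literature.Probability.Percolation
open Literature.Probability.RandomPlanarGeometry (DobrushinDomain)
open Summit.CriticalPhenomena.CardyFormulaZ2.Theses.CardyComplexCone

noncomputable section

/-! ## The reflection `ρ (x₀, x₁) = (-x₀, x₁)` -/

/-- Coordinates of the reflection. -/
theorem reflect_coord_JF (x : Site 2) : reflectIso (0 : Fin 2) x 0 = -x 0 ∧ reflectIso (0 : Fin 2) x 1 = x 1 :=
  ⟨reflectIso_apply_same 0 x, reflectIso_apply_of_ne (by decide) x⟩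

/-- The reflection is an involution: its inverse is itself. -/
theorem reflect_symm_apply_JF (x : Site 2) : (reflectIso (0 : Fin 2)).symm x = reflectIso (0 : Fin 2) x := by
  rw [RelIso.symm_apply_eq]
  rw [Site.eq_iff_two]
  obtain ⟨h0, h1⟩ := reflect_coord_JF (reflectIso (0 : Fin 2) x)
  obtain ⟨h0', h1'⟩ := reflect_coord_JF x
  omega

/-- Relabelling along the reflection: `e ∈ ρ '' ω ↔ ρ '' e ∈ ω`. -/
theorem mem_relabel_reflect_iff_JF (ω : BondConfig (Site 2)) (e : Sym2 (Site 2)) :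
    e ∈ BondConfig.relabel (sym2Equiv (reflectIso (0 : Fin 2)).toEquiv) ω ↔ Sym2.map (reflectIso (0 : Fin 2)) e ∈ ω := by
  rw [BondConfig.mem_relabel_iff, sym2Equiv_symm]
  induction e using Sym2.ind with
  | h x y =>
    rw [sym2Equiv_mk, Sym2.map_mk]
    change s((reflectIso (0 : Fin 2)).symm x, (reflectIso (0 : Fin 2)).symm y) ∈ ω ↔ _
    rw [reflect_symm_apply_JF, reflect_symm_apply_JF]

/-- **Mirrored faces have mirrored separating edges**: for adjacent faces `f`, `f'`, the edge
separating the mirrored faces `ρ f - e₀`, `ρ f' - e₀` is the mirror image of `sepEdge f f'`. -/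
theorem sepEdge_reflect_JF {f f' : Site 2} (h : (zdGraph 2).Adj f f') :
    sepEdge (reflectIso (0 : Fin 2) f - cornerUnit 0) (reflectIso (0 : Fin 2) f' - cornerUnit 0) =
      Sym2.map (reflectIso (0 : Fin 2)) (sepEdge f f') := by
  rw [show sepEdge f f' = s(sepLo f f', sepHi f f') from rfl, Sym2.map_mk]
  have hadj : (zdGraph 2).Adj (reflectIso (0 : Fin 2) f - cornerUnit 0) (reflectIso (0 : Fin 2) f' - cornerUnit 0) := by
    have := (reflectIso (0 : Fin 2)).map_rel_iff.2 h
    rw [adj_iff_coord_JF] at this ⊢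
    simp only [Pi.sub_apply, cornerUnit_zero_apply_zero, cornerUnit_zero_apply_one]
    omega
  refine sepEdge_eq_of_sum_JF hadj ((reflectIso (0 : Fin 2)).map_rel_iff.2 (adj_sepLo_sepHi_JF f f')) fun i => ?_
  have hs := sepLo_add_sepHi_JF h
  obtain ⟨a0, a1⟩ := reflect_coord_JF (sepLo f f')
  obtain ⟨b0, b1⟩ := reflect_coord_JF (sepHi f f')
  obtain ⟨c0, c1⟩ := reflect_coord_JF f
  obtain ⟨d0, d1⟩ := reflect_coord_JF f'
  have hs0 := hs 0
  have hs1 := hs 1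
  fin_cases i <;> simp only [Pi.sub_apply, cornerUnit_zero_apply_zero, cornerUnit_zero_apply_one,
    Fin.zero_eta, Fin.mk_one, Fin.isValue] <;> omega

/-- Relabelling along a composite automorphism is the composite relabelling. -/
theorem relabel_trans_JF (φ₁ φ₂ : zdGraph 2 ≃g zdGraph 2) (ω : BondConfig (Site 2)) :
    BondConfig.relabel (sym2Equiv (φ₁.trans φ₂).toEquiv) ω =
      BondConfig.relabel (sym2Equiv φ₂.toEquiv) (BondConfig.relabel (sym2Equiv φ₁.toEquiv) ω) := by
  ext e
  rw [BondConfig.mem_relabel_iff, BondConfig.mem_relabel_iff, BondConfig.mem_relabel_iff, sym2Equiv_symm,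
    sym2Equiv_symm, sym2Equiv_symm]
  induction e using Sym2.ind with
  | h x y => rw [sym2Equiv_mk, sym2Equiv_mk, sym2Equiv_mk]; rfl

/-! ## Reading the gate in the frame -/

/-- **The arch of the gate, read in the frame, for either chirality** (registered anchor
`gate_read_JF` of stmt-CriticalPhenomena-11387). Let `ω'` be a configuration (the physical
configuration relabelled along the frame `ψ`) and `s = ±1`. If `ω'` (`s = 1`), resp. its mirror
image `ρ '' ω'` (`s = -1`), lies in the reference gate `ufrsGateRef corner N h`, then there are a
vertex `v₀`, a corner index `k₀`, an `ω'`-open lattice walk `P` from `v₀` to `u` and a face walk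
`Q` from `cFace (v₀, k₀)` to `g` each of whose steps crosses an `ω'`-closed edge, such that the
vertices of `P` (and `u`) are mirror images `x₀ ↦ s x₀` of points of `ufrsGateRA corner N h`
(`ufrsGateFA`), and the faces of `Q` (and `g`) are mirrored faces `f₀ ↦ s f₀ - (1 - s)/2` of faces
of `ufrsGateRB corner N h` (`ufrsGateFB`). -/
theorem gate_read_JF : ∀ (ω' : BondConfig (Site 2)) (s : ℤ) (corner : Bool) (N h : ℕ), (s = 1 ∨ s = -1) → (s = 1 → ω' ∈ ufrsGateRef corner N h) → (s = -1 → BondConfig.relabel (sym2Equiv (reflectIso (0 : Fin 2)).toEquiv) ω' ∈ ufrsGateRef corner N h) → ∃ (v₀ u g : Site 2) (k₀ : Fin 4) (P : (zdGraph 2).Walk v₀ u) (Q : (zdGraph 2).Walk (cFace (v₀, k₀)) g), (∀ e ∈ P.edges, e ∈ ω') ∧ (∀ d ∈ Q.darts, sepEdge d.fst d.snd ∉ ω') ∧ (∀ z ∈ P.support, ∃ z' ∈ ufrsGateRA corner N h, z 0 = s * z' 0 ∧ z 1 = z' 1) ∧ (∃ u' ∈ ufrsGateFA corner N h, u 0 =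 s * u' 0 ∧ u 1 = u' 1) ∧ (∀ f ∈ Q.support, ∃ f' ∈ ufrsGateRB corner N h, 2 * f 0 = 2 * s * f' 0 - (1 - s) ∧ f 1 = f' 1) ∧ (∃ g' ∈ ufrsGateFB corner N h, 2 * g 0 = 2 * s * g' 0 - (1 - s) ∧ g 1 = g' 1) := by
  intro ω' s corner N h hs h1 h2
  rcases hs with rfl | rfl
  · -- standard chirality: the reference arch itself
    obtain ⟨v₀, u, f₀, g, P, Q, hcor, -, -, hPR, huF, hPe, hQR, hgF, hQe, -⟩ :=
      (mem_ufrsGateWith_iff _ _ _ _ _).1 ((ufrsGateRef_eq corner N h) ▸ h1 rfl)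
    obtain ⟨k₀, hk₀⟩ := exists_faceAt_of_isCorner hcor
    refine ⟨v₀, u, g, k₀, P, Q.copy hk₀ rfl, hPe, ?_, ?_, ⟨u, huF, by simp, rfl⟩, ?_, ⟨g, hgF, by ring, rfl⟩⟩
    · intro d hd
      rw [SimpleGraph.Walk.darts_copy] at hd
      exact hQe d hd
    · intro z hz
      exact ⟨z, hPR z hz, by simp, rfl⟩
    · intro f hf
      rw [SimpleGraph.Walk.support_copy] at hf
      exact ⟨f, hQR f hf, by ring, rfl⟩
  · -- opposite chirality: the mirror image of the reference arch
    obtain ⟨v₀, u, f₀, g, P, Q, hcor, -, -, hPR, huF, hPe, hQR, hgF, hQe, -⟩ :=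
      (mem_ufrsGateWith_iff _ _ _ _ _).1 ((ufrsGateRef_eq corner N h) ▸ h2 rfl)
    set ρF : zdGraph 2 ≃g zdGraph 2 := (reflectIso (0 : Fin 2)).trans (zdShiftIso (-cornerUnit 0)) with hρF
    have hρF_apply : ∀ f, ρF f = reflectIso (0 : Fin 2) f - cornerUnit 0 := fun f => by rw [hρF, sub_eq_add_neg]; rfl
    have hcor' : Literature.Probability.LatticeModels.IsCorner (reflectIso (0 : Fin 2) v₀) (ρF f₀) := by
      intro i
      rw [hρF_apply]
      obtain ⟨a0, a1⟩ := reflect_coord_JF v₀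
      obtain ⟨b0, b1⟩ := reflect_coord_JF f₀
      have h0 := hcor 0
      have h1 := hcor 1
      fin_cases i <;> simp only [Pi.sub_apply, cornerUnit_zero_apply_zero, cornerUnit_zero_apply_one,
        Fin.zero_eta, Fin.mk_one, Fin.isValue] <;> omega
    obtain ⟨k₀, hk₀⟩ := exists_faceAt_of_isCorner hcor'
    refine ⟨reflectIso (0 : Fin 2) v₀, reflectIso (0 : Fin 2) u, ρF g, k₀, P.map (reflectIso (0 : Fin 2)).toEmbedding.toHom, (Q.map ρF.toEmbedding.toHom).copy hk₀ rfl, ?_, ?_, ?_, ?_, ?_, ?_⟩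
    · intro e he
      rw [SimpleGraph.Walk.edges_map, List.mem_map] at he
      obtain ⟨e₁, he₁, rfl⟩ := he
      exact (mem_relabel_reflect_iff_JF ω' e₁).1 (hPe e₁ he₁)
    · intro d hd
      rw [SimpleGraph.Walk.darts_copy, SimpleGraph.Walk.darts_map, List.mem_map] at hd
      obtain ⟨d₁, hd₁, rfl⟩ := hd
      intro hmem
      apply hQe d₁ hd₁
      rw [mem_relabel_reflect_iff_JF, ← sepEdge_reflect_JF d₁.adj]
      change sepEdge (ρF d₁.fst) (ρF d₁.snd) ∈ ω' at hmem
      rwa [hρF_apply, hρF_apply] at hmem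
    · intro z hz
      rw [SimpleGraph.Walk.support_map, List.mem_map] at hz
      obtain ⟨z₁, hz₁, rfl⟩ := hz
      obtain ⟨a0, a1⟩ := reflect_coord_JF z₁
      exact ⟨z₁, hPR z₁ hz₁, by change reflectIso (0 : Fin 2) z₁ 0 = _; rw [a0]; ring, a1⟩
    · obtain ⟨a0, a1⟩ := reflect_coord_JF u
      exact ⟨u, huF, by rw [a0]; ring, a1⟩
    · intro f hf
      rw [SimpleGraph.Walk.support_copy, SimpleGraph.Walk.support_map, List.mem_map] at hf
      obtain ⟨f₁, hf₁, rfl⟩ := hf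
      obtain ⟨a0, a1⟩ := reflect_coord_JF f₁
      refine ⟨f₁, hQR f₁ hf₁, ?_, ?_⟩
      · change 2 * ρF f₁ 0 = _
        rw [hρF_apply, Pi.sub_apply, a0, cornerUnit_zero_apply_zero]; ring
      · change ρF f₁ 1 = _
        rw [hρF_apply, Pi.sub_apply, a1, cornerUnit_zero_apply_one]; ring
    · obtain ⟨a0, a1⟩ := reflect_coord_JF g
      refine ⟨g, hgF, ?_, ?_⟩
      · rw [hρF_apply, Pi.sub_apply, a0, cornerUnit_zero_apply_zero]; ring
      · rw [hρF_apply, Pi.sub_apply, a1, cornerUnit_zero_apply_one]; ring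

end

end Summit.CriticalPhenomena.CardyFormulaZ2.Cruxes.EdgePrecompact.QkzStripBoundaryArm
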